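import Summits.QuantumFields.BalabanUV.Beta.TubeZeroFreeEnds
import Summits.QuantumFields.BalabanUV.Beta.VertexToriSymmetryCovariantQ
import Summits.QuantumFields.BalabanUV.Beta.ResolventBoxCertificate

/-!
# Beta / TubeZeroFreeSymmetry — THEOREM DB's two inputs under the cell's symmetries: (F) from the SAME quarter-region box leaves as `hBa`,
# (W) reference slices modulo negation and the G6 conjugations (β sub-cell, BINDER-OWNERS row CAP-k, lineage `b2b-balaban-beta-an5`, gen 23;
# node BETA-an5-g23-THEOREM-DB, leaf 3c; journal CLAIM l.14161)

* §1 **(F) FROM THE (Z2a) LEAVES**: `det_ne_zero_vertexTori_of_negConjRegion` ∕ `det_ne_zero_vertexTori_of_boxes_negConjRegion` — for a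
  family with `MatNegTranspose A` (`A(−q) = A(q)ᵀ`, the bordered `k₀`: cap3-g15 G6 note (iii)) and `MatConjSymm A` (real tables), zero-freeness
  of `det A` on the QUARTER REGION `{Im q_{ν₀} = +w_{ν₀}, Re q_{ν₁} ≤ 0}` of the vertex tori gives it on ALL `2^{d+1}` vertex tori; and the
  SAME `(boxes, hcov, hcert)` data that feed `ResolventBoxCertificate.hBa_of_boxes_negConjRegion` (route A's `hBa`) feed (F): every leaf
  certificate `IsUnit (A q).det ∧ ‖(A q)⁻¹‖ ≤ B` carries the determinant.  ⟹ under the L-CF branch run at the zero-free width, (F) is FREE.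
* §2 **(W) MODULO SYMMETRY**: `SliceWindingEq.neg` (G even under `q ↦ −q` — for `det k₀` from `MatNegTranspose`: `det_neg_of_matNegTranspose`
  — the pattern `s` and `−s` need ONE reference slice), `SliceWindingEq.reflect_of_matCovariantQ` (a G6 conjugation
  `MatCovariantQ (reflectAt (succAbove i j)) U V A`, `V·U = 1` ⟹ flipping the `j`-th sign is free, via `matCovariantQ_det_eq`).  For the cell's
  `det k₀` with R₂, R₃ (kernel via `TableCovariance` once the entry form is supplied) and negation: the 4 × 8 = 32 reference slices of
  `TubeHol.ne_zero_of_vertexTori` reduce to 6 (i ∈ {0,1}: 1 each; i ∈ {2,3}: 2 each); with R₀, R₁ as well: 4.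

HONEST FRAMING.  Kernel glue ([folklore]); which symmetries the cell's tables have is a HYPOTHESIS here (evidence: cap3 G6-TABLECOV, cap4 g6modp,
cap-ref R81-a/b — outside the kernel until the typed tables exist); no number, no binder instance; NOT BetaPertH, NOT continuum, NOT Clay.
0 `sorry`, 0 cite tags.
-/

namespace Summit.QuantumFields.BalabanUV.Beta.TubeZeroFreeSymmetry

open Complex Set Matrix
open Summit.QuantumFields.BalabanUV.Beta.TubeMaximumModulus
open Summit.QuantumFields.BalabanUV.Beta.WindingIncrement
open Summit.QuantumFields.BalabanUV.Beta.LoopIncrement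
open Summit.QuantumFields.BalabanUV.Beta.VertexToriSymmetry
open Summit.QuantumFields.BalabanUV.Beta.ConjReflectionAlgebra (MatConjSymm conjNeg conjNeg_apply)
open Summit.QuantumFields.BalabanUV.Beta.ResolventBoxCertificate (Box)
open scoped Real ComplexConjugate Matrix.Norms.L2Operator

noncomputable section

variable {d : ℕ} {n : Type*} [Fintype n] [DecidableEq n]
variable {A : (Fin (d + 1) → ℂ) → Matrix n n ℂ} {w : Fin (d + 1) → ℝ}

/-! ## §1 (F) on all vertex tori from the quarter region — the same leaves as `hBa` -/

/-- the determinant of a `MatNegTranspose` family is EVEN: `det A(−q) = det A(q)`. [folklore] -/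
theorem det_neg_of_matNegTranspose (hA : MatNegTranspose A) (q : Fin (d + 1) → ℂ) : (A (-q)).det = (A q).det := by
  rw [hA q, Matrix.det_transpose]

/-- **(F) FROM THE QUARTER REGION**: `A(−q) = A(q)ᵀ` and `MatConjSymm A` ⟹ zero-freeness of `det A` on `{Im q_{ν₀} = +w_{ν₀}, Re q_{ν₁} ≤ 0}`
gives zero-freeness on ALL vertex tori (negation flips every imaginary sign and keeps `det`; `conjNeg` flips real parts and conjugates `det`). [folklore] -/
theorem det_ne_zero_vertexTori_of_negConjRegion (hA : MatNegTranspose A) (hA' : MatConjSymm A) (ν₀ ν₁ : Fin (d + 1))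
    (hreg : ∀ q ∈ VertexTori w, (q ν₀).im = w ν₀ → (q ν₁).re ≤ 0 → (A q).det ≠ 0) :
    ∀ q ∈ VertexTori w, (A q).det ≠ 0 := by
  refine of_negRegion (P := fun q => (A q).det ≠ 0) ν₀ (fun q _ h => by rw [det_neg_of_matNegTranspose hA]; exact h) ?_
  intro q hq h0
  exact of_conjNegRegion (P := fun q => (q ν₀).im = w ν₀ → (A q).det ≠ 0) ν₁
    (fun q _ hPq him => by
      have e : (A (conjNeg q)).det = conj ((A q).det) := hA'.det q
      rw [e]
      exact (map_ne_zero _).mpr (hPq (by simpa [conjNeg_apply] using him)))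
    (fun q hq hre him => hreg q hq him hre) q hq h0

/-- **(F) FROM THE SAME BOX LEAVES AS `hBa`**: the data `(boxes, hcov, hcert)` of `ResolventBoxCertificate.hBa_of_boxes_negConjRegion` — boxes
covering the quarter region, per-box certificates `IsUnit (A q).det ∧ ‖(A q)⁻¹‖ ≤ B` — give `det (A q) ≠ 0` on all vertex tori. [folklore] -/
theorem det_ne_zero_vertexTori_of_boxes_negConjRegion (hA : MatNegTranspose A) (hA' : MatConjSymm A) (ν₀ ν₁ : Fin (d + 1))
    {ι : Type*} (boxes : Finset ι) (ctr : ι → Fin (d + 1) → ℂ) (hw : ι → Fin (d + 1) → ℝ)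
    (hcov : ∀ q ∈ VertexTori w, (q ν₀).im = w ν₀ → (q ν₁).re ≤ 0 → ∃ b ∈ boxes, q ∈ Box (ctr b) (hw b)) {B : ℝ}
    (hcert : ∀ b ∈ boxes, ∀ q ∈ Box (ctr b) (hw b), IsUnit (A q).det ∧ ‖(A q)⁻¹‖ ≤ B) :
    ∀ q ∈ VertexTori w, (A q).det ≠ 0 :=
  det_ne_zero_vertexTori_of_negConjRegion hA hA' ν₀ ν₁ fun q hq h0 h1 => by
    obtain ⟨b, hb, hqb⟩ := hcov q hq h0 h1
    exact (hcert b hb q hqb).1.ne_zero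

/-! ## §2 (W) reference slices modulo negation and conjugation symmetries -/

section Slices

variable {G : (Fin (d + 1) → ℂ) → ℂ}

/-- inserting commutes with negation. [folklore] -/
theorem insertNth_neg (i : Fin (d + 1)) (z : ℂ) (q : Fin d → ℂ) :
    (i.insertNth (-z) (-q) : Fin (d + 1) → ℂ) = -(i.insertNth z q) := by
  funext μ
  refine Fin.succAboveCases i ?_ ?_ μ
  · rw [Pi.neg_apply, Fin.insertNth_apply_same, Fin.insertNth_apply_same]
  · intro k; rw [Pi.neg_apply, Fin.insertNth_apply_succAbove, Fin.insertNth_apply_succAbove, Pi.neg_apply]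

/-- for an EVEN multiplier the slice through `−q` is the slice through `q` reversed: `slice G i (−q) z = slice G i q (−z)`. [folklore] -/
theorem slice_neg (hN : ∀ p, G (-p) = G p) (i : Fin (d + 1)) (q : Fin d → ℂ) (z : ℂ) :
    slice G i (-q) z = slice G i q (-z) := by
  rw [slice_apply, slice_apply, ← hN (i.insertNth (-z) q), ← insertNth_neg, neg_neg]

/-- **(W) UNDER NEGATION**: for an even `G` (`G(−p) = G p`; for `det k₀` from `A(−q) = A(q)ᵀ`), `SliceWindingEq` at `q` gives it at `−q`
(the top line of the `−q` slice is the bottom line of the `q` slice traversed backwards: both increments change sign). [folklore] -/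
theorem SliceWindingEq.neg (hN : ∀ p, G (-p) = G p) {i : Fin (d + 1)} {q : Fin d → ℂ} (hW : SliceWindingEq G w i q) :
    SliceWindingEq G w i (-q) := by
  obtain ⟨Lp, Lm, hLp, hLm, e⟩ := hW
  have hrel : ∀ s x : ℝ, hEdge (slice G i (-q)) s x = hEdge (slice G i q) (-s) (-x) := by
    intro s x
    rw [hEdge_apply, hEdge_apply, slice_neg hN]
    congr 1; push_cast; ring
  have hp' : IsContLog (hEdge (slice G i (-q)) (w i)) (-π) π (fun x => Lm (-x)) := by
    have h := hLm.comp_neg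
    rw [neg_neg] at h
    exact h.congr fun x _ => by simp only [hrel]
  have hm' : IsContLog (hEdge (slice G i (-q)) (-(w i))) (-π) π (fun x => Lp (-x)) := by
    have h := hLp.comp_neg
    rw [neg_neg] at h
    exact h.congr fun x _ => by simp only [hrel, neg_neg]
  refine ⟨_, _, hp', hm', ?_⟩
  simp only [neg_neg]
  linear_combination e

/-- **(W) UNDER A G6 CONJUGATION**: if the matrix family is covariant under the reflection of direction `succAbove i j` with `q`-dependent
conjugators (`MatCovariantQ (reflectAt (i.succAbove j)) U V A`, `V q · U q = 1` — `TableCovariance.matCovariantQ_characterSum_relabel`), then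
`SliceWindingEq (det ∘ A)` at `q` gives it at `q` with the `j`-th coordinate negated. [folklore] -/
theorem SliceWindingEq.reflect_of_matCovariantQ {U V : (Fin (d + 1) → ℂ) → Matrix n n ℂ} {i : Fin (d + 1)} (j : Fin d)
    (hVU : ∀ q, V q * U q = 1) (hA : MatCovariantQ (reflectAt (i.succAbove j)) U V A) {q : Fin d → ℂ}
    (hW : SliceWindingEq (fun p => (A p).det) w i q) :
    SliceWindingEq (fun p => (A p).det) w i (Function.update q j (-q j)) :=
  hW.reflect j fun p => matCovariantQ_det_eq hVU hA p

/-- the reference point of a sign class, purely imaginary: `Im = s_j · w_j`, `Re = 0`. [folklore] -/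
def refPoint (w' : Fin d → ℝ) (s : Fin d → ℝ) : Fin d → ℂ := fun j => ((s j * w' j : ℝ) : ℂ) * I

/-- its imaginary parts. [folklore] -/
@[simp] theorem refPoint_im (w' s : Fin d → ℝ) (j : Fin d) : (refPoint w' s j).im = s j * w' j := by simp [refPoint]

/-- negating the sign pattern negates the reference point. [folklore] -/
theorem refPoint_neg (w' s : Fin d → ℝ) : refPoint w' (-s) = -refPoint w' s := by
  funext j; simp [refPoint]

/-- flipping one sign of the pattern updates one coordinate of the reference point by negation. [folklore] -/
theorem refPoint_update (w' s : Fin d → ℝ) (j : Fin d) :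
    refPoint w' (Function.update s j (-s j)) = Function.update (refPoint w' s) j (-refPoint w' s j) := by
  funext k
  by_cases hk : k = j
  · subst hk; simp [refPoint]
  · simp [refPoint, Function.update_of_ne hk]

/-- **THE (W) HYPOTHESIS OF THEOREM DB FROM A SET OF REPRESENTATIVE PATTERNS**: if every sign pattern `s` is carried to a REPRESENTATIVE
`ρ s` by finitely many symmetry moves each of which transports `SliceWindingEq` between reference points (packaged as the hypothesis
`hmove`), then (W) at the representatives gives (W) everywhere, in the exact shape `TubeHol.ne_zero_of_vertexTori` consumes. [folklore] -/
theorem windingHyp_of_representatives (i : Fin (d + 1)) (ρ : (Fin d → ℝ) → (Fin d → ℝ))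
    (hmove : ∀ s : Fin d → ℝ, (∀ j, s j = 1 ∨ s j = -1) →
      SliceWindingEq G w i (refPoint (fun j => w (i.succAbove j)) (ρ s)) →
        SliceWindingEq G w i (refPoint (fun j => w (i.succAbove j)) s))
    (hW : ∀ s : Fin d → ℝ, (∀ j, s j = 1 ∨ s j = -1) → SliceWindingEq G w i (refPoint (fun j => w (i.succAbove j)) (ρ s))) :
    ∀ s : Fin d → ℝ, (∀ j, s j = 1 ∨ s j = -1) →
      ∃ q₀ : Fin d → ℂ, (∀ j, (q₀ j).im = s j * w (i.succAbove j)) ∧ SliceWindingEq G w i q₀ :=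
  fun s hs => ⟨refPoint _ s, fun j => refPoint_im _ s j, hmove s hs (hW s hs)⟩

end Slices

end

end Summit.QuantumFields.BalabanUV.Beta.TubeZeroFreeSymmetry
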